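import Summits.QuantumAdvantage.QuantumAdvantage.Theorems.CubicForrelationSignedExactCubicForrelationNotPrBPPGrowMachine
import Literature.Computability.QuantumComplexity.MSubspaceSignReadoutRelaxedRuns
import Literature.Computability.Complexity.CoinChunks
import Literature.Computability.Complexity.GabberGalil

/-!
# Crux `CubicForrelation.SignedExactCubicForrelationNotPrBPP` (stmt-QuantumAdvantage-13932), line `dual-pingpong-frame`
# (GROW reshape): the GROW machine, XIII — coins, the run as a fold over chunks, and the numerical bound

Proof-only support file (`--supports stmt-QuantumAdvantage-13932`) toward the registered stub `stub_growFinder`; sequel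
of `…GrowMachine.lean`. Bookkeeping for the completeness proof:

* reading coins through prefixes (`coinVec_take`; the take/drop form is `MMReadout.coinVec_eq_take_drop`): the data of
  job `r` of a trial only read the first `(r+1) n` coins of the chunk and decode as the blocks of `chunkVec`
  (`cand_take`, `cand_blocks`);
* the initial state `([], [])` passes both checks; the run keeps any invariant kept by the trials (`foldl_inv`), reads
  only the first `numTrials n · chunkLen n` coins (`runY_take`), and on a string of exactly that length is a fold over
  the take/drop blocks (`runY_eq_run`);
* the coin polynomial `3 (X+1)² (X+3)¹⁰` dominates `numTrials n · chunkLen n = 3 n² (n+2)¹⁰` under the size guard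
  (`total_le_growPoly`), and the numerical bound `n · (1 - (n+2)⁻⁸)^{3 (n+2)⁹} ≤ 1/3` (`stage_bound`, by Bernoulli's
  inequality `GabberGalil.one_sub_pow_le`).

## References

* S. Arora, B. Barak, *Computational Complexity: A Modern Approach*, CUP 2009, §7.1, §7.4.1. [AroraBarak2009]
-/

noncomputable section

set_option linter.dupNamespace false -- D-0017: single-problem summit ⇒ `QuantumAdvantage.QuantumAdvantage` by design

namespace Summit.QuantumAdvantage.QuantumAdvantage.Theorems.SignedExactCubicForrelationNotPrBPP.GrowMachine

open Finset
open Literature.Computability.Complexity Literature.Computability.QuantumComplexity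
open Literature.Computability.Complexity.F2Elim
open ForrCode QuadSampler MMReadout CubicDequant
open FinderMachine (Vec Mat normV basisOf kerOf inSpan)

variable {n m : ℕ}

/-! ### Reading coins through prefixes (`MMReadout.coinVec_eq_take_drop` gives the take/drop form) -/

/-- `coinVec` through a long enough prefix. [folklore] -/
theorem coinVec_take (y : List Bool) {K L o : ℕ} (h : o + L ≤ K) : coinVec (y.take K) L o = coinVec y L o := by
  unfold coinVec
  refine List.map_congr_left fun i hi => ?_
  have hi' := List.mem_range.1 hi
  rw [List.getD_eq_getElem?_getD, List.getD_eq_getElem?_getD, List.getElem?_take, if_pos (by omega)]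

/-- The probes of job `r`: the blocks at offsets `(j+1) n`, `j < r`. [folklore] -/
theorem probesOf_take {r : ℕ} (hr : r ≤ n + 1) (c : List Bool) :
    (probesOf n c).take r = (List.range r).map fun j => coinVec c n ((j + 1) * n) := by
  rw [probesOf, ← List.map_take, List.take_range, Nat.min_eq_left hr]

/-- The candidate data of job `r` only read the first `(r+1) n` coins. [folklore] -/
theorem cand_take {r : ℕ} (hr : r ≤ n + 1) (c : List Bool) :
    (probesOf n (c.take ((r + 1) * n))).take r = (probesOf n c).take r ∧ selOf n (c.take ((r + 1) * n)) = selOf n c := by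
  refine ⟨?_, coinVec_take c (by nlinarith)⟩
  rw [probesOf_take hr, probesOf_take hr]
  refine List.map_congr_left fun j hj => coinVec_take c ?_
  have := List.mem_range.1 hj
  nlinarith

/-- On a string of length `(r+1) n` the candidate data are the blocks of the chunk decoding. [folklore] -/
theorem cand_blocks {r : ℕ} (hr : r ≤ n + 1) {w : List Bool} (hw : w.length = (r + 1) * n) :
    (probesOf n w).take r = List.ofFn (fun j : Fin r => (chunkVec (J := r + 1) (A := n) ⟨w, hw⟩ j.succ).toList) ∧
      selOf n w = (chunkVec (J := r + 1) (A := n) ⟨w, hw⟩ 0).toList := by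
  constructor
  · rw [probesOf_take hr]
    apply List.ext_getElem (by rw [List.length_map, List.length_range, List.length_ofFn])
    intro i h1 h2
    rw [List.length_map, List.length_range] at h1
    rw [List.getElem_map, List.getElem_range, List.getElem_ofFn]
    show coinVec w n ((i + 1) * n) = (w.drop (((⟨i, h1⟩ : Fin r).succ : ℕ) * n)).take n
    rw [Fin.val_succ, coinVec_eq_take_drop w (by rw [hw]; nlinarith)]
  · show coinVec w n 0 = (w.drop ((0 : ℕ) * n)).take n
    rw [coinVec_eq_take_drop w (by rw [hw]; nlinarith), Nat.zero_mul]

/-- A vector's list read in `{0,1}ⁿ` is the vector. [folklore] -/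
theorem toInput_toList (v : List.Vector Bool n) : toInput n v.toList = Equiv.vectorEquivFin Bool n v := by
  funext i
  show v.toList.getD i false = v.get i
  rw [List.Vector.get_eq_get_toList, List.getD_eq_getElem _ _ (by rw [v.toList_length]; exact i.isLt)]
  rfl


/-! ### The initial state -/

/-- `Λ([]) = []`: the empty list passes every closedness check. [folklore] -/
theorem closedChk_nil (c : PCirc) (U : Mat) : closedChk n c [] U = true := by
  rw [closedChk, lamOf, stackOf, offsOf]; rfl

/-- The empty pair passes the orthogonality check. [folklore] -/
theorem orthChk_nil : orthChk n ([] : Mat) [] = true := rfl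

/-- The empty pair is not terminal unless `m = 0`, and is terminal when `m = 0`. [folklore] -/
theorem terminal_nil : terminal m (([] : Mat), ([] : Mat)) = decide (0 = m) := by
  rw [terminal]; simp

/-! ### Folds keep invariants -/

/-- A left fold keeps an invariant kept by its step. [folklore] -/
theorem foldl_inv {α σ : Type} (P : σ → Prop) (F : σ → α → σ) (hF : ∀ s a, P s → P (F s a)) :
    ∀ (l : List α) (s : σ), P s → P (l.foldl F s) := by
  intro l
  induction l with
  | nil => intro s hs; exact hs
  | cons a l ih => intro s hs; exact ih _ (hF s a hs)

/-! ### The run reads a bounded prefix, in blocks -/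

/-- **The run only reads the first `numTrials n · chunkLen n` coins.** [folklore] -/
theorem runY_take (n m : ℕ) (cf cg : PCirc) (y : List Bool) :
    runY n m cf cg (y.take (numTrials n * chunkLen n)) = runY n m cf cg y := by
  unfold runY
  refine List.foldl_ext _ _ _ (fun p t ht => ?_)
  have ht' := List.mem_range.1 ht
  rw [coinVec_take y]
  calc t * chunkLen n + chunkLen n = (t + 1) * chunkLen n := by ring
    _ ≤ numTrials n * chunkLen n := Nat.mul_le_mul_right _ ht'

/-- **On a string of length `numTrials n · chunkLen n` the run is the block-form run.** [folklore] -/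
theorem runY_eq_run (n m : ℕ) (cf cg : PCirc) {y : List Bool} (hy : y.length = numTrials n * chunkLen n) :
    runY n m cf cg y = (List.range (numTrials n)).foldl (fun p t => trialC n m cf cg p ((y.drop (t * chunkLen n)).take (chunkLen n))) ([], []) := by
  unfold runY
  refine List.foldl_ext _ _ _ (fun p t ht => ?_)
  have ht' := List.mem_range.1 ht
  refine congrArg _ (coinVec_eq_take_drop y ?_)
  rw [hy]
  calc t * chunkLen n + chunkLen n = (t + 1) * chunkLen n := by ring
    _ ≤ numTrials n * chunkLen n := Nat.mul_le_mul_right _ ht'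

/-- The block-form run, one more chunk. [folklore] -/
theorem run_succ {σ : Type} (F : σ → List Bool → σ) (s₀ : σ) (C k : ℕ) (y : List Bool) :
    (List.range (k + 1)).foldl (fun p t => F p ((y.drop (t * C)).take C)) s₀ =
      F ((List.range k).foldl (fun p t => F p ((y.drop (t * C)).take C)) s₀) ((y.drop (k * C)).take C) := by
  rw [List.range_succ, List.foldl_append, List.foldl_cons, List.foldl_nil]

/-! ### The coin polynomial -/

/-- **The coin polynomial** `3 (X+1)² (X+3)¹⁰`. [folklore] -/
theorem growPoly_eval (ℓ : ℕ) : (3 * (Polynomial.X + 1) ^ 2 * (Polynomial.X + 3) ^ 10 : Polynomial ℕ).eval ℓ = 3 * (ℓ + 1) ^ 2 * (ℓ + 3) ^ 10 := by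
  simp

/-- Under the size guard the coin polynomial covers every coin the run reads. [folklore] -/
theorem total_le_growPoly {n ℓ : ℕ} (h : n ≤ ℓ + 1) :
    numTrials n * chunkLen n ≤ (3 * (Polynomial.X + 1) ^ 2 * (Polynomial.X + 3) ^ 10 : Polynomial ℕ).eval ℓ := by
  rw [growPoly_eval, numTrials, chunkLen]
  have h1 : n * n ≤ (ℓ + 1) ^ 2 := by rw [sq]; exact Nat.mul_le_mul h h
  have h2 : (n + 2) ^ 9 * (n + 2) ≤ (ℓ + 3) ^ 10 := by
    rw [← pow_succ]; exact Nat.pow_le_pow_left (by omega) 10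
  calc n * (3 * (n + 2) ^ 9) * ((n + 2) * n) = 3 * (n * n) * ((n + 2) ^ 9 * (n + 2)) := by ring
    _ ≤ 3 * (ℓ + 1) ^ 2 * (ℓ + 3) ^ 10 := by gcongr

/-! ### The numerical bound -/

/-- **The stage bound**: `n · (1 - (n+2)⁻⁸)^{3 (n+2)⁹} ≤ 1/3`. [cite: AroraBarak2009, §7.4.1] -/
theorem stage_bound (n : ℕ) : (n : ℝ) * (1 - 1 / ((n : ℝ) + 2) ^ 8) ^ (3 * (n + 2) ^ 9) ≤ 1 / 3 := by
  have hq0 : (0 : ℝ) ≤ 1 / ((n : ℝ) + 2) ^ 8 := by positivity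
  have hq1 : 1 / ((n : ℝ) + 2) ^ 8 ≤ 1 := by
    rw [div_le_one (by positivity)]
    exact one_le_pow₀ (by linarith [n.cast_nonneg (α := ℝ)])
  have hB := GabberGalil.one_sub_pow_le hq0 hq1 (3 * (n + 2) ^ 9)
  have hT : ((3 * (n + 2) ^ 9 : ℕ) : ℝ) * (1 / ((n : ℝ) + 2) ^ 8) = 3 * ((n : ℝ) + 2) := by
    push_cast
    field_simp
  rw [hT] at hB
  have hn : (0 : ℝ) ≤ n := n.cast_nonneg
  calc (n : ℝ) * (1 - 1 / ((n : ℝ) + 2) ^ 8) ^ (3 * (n + 2) ^ 9) ≤ (n : ℝ) * (1 / (1 + 3 * ((n : ℝ) + 2))) :=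
        mul_le_mul_of_nonneg_left hB hn
    _ ≤ 1 / 3 := by
        rw [mul_one_div, div_le_div_iff₀ (by positivity) (by norm_num)]
        linarith

/-- **The stage bound** `n · (1 - (n+2)⁻⁸)^{3 (n+2)⁹} ≤ 1/3` (registered brick `grow_stageBound` of stub `stub_growFinder`, line `dual-pingpong-frame`, crux stmt-QuantumAdvantage-13932). [cite: AroraBarak2009, §7.4.1] -/
theorem grow_stageBound : ∀ (n : ℕ), (n : ℝ) * (1 - 1 / ((n : ℝ) + 2) ^ 8) ^ (3 * (n + 2) ^ 9) ≤ 1 / 3 :=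
  fun n => stage_bound n

end Summit.QuantumAdvantage.QuantumAdvantage.Theorems.SignedExactCubicForrelationNotPrBPP.GrowMachine

end
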